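import Summits.AtomisticToContinuum.FouriersLaw.Theses.CoercivePulse
import Summits.AtomisticToContinuum.FouriersLaw.Theorems.EmbeddedDrudeMourreAbelThermodynamicLimitRegularityIffCommonLimit
import Summits.AtomisticToContinuum.FouriersLaw.Theorems.CageBudgetFeketeHeatVarianceCalculus
import HarnessLib

/-!
# `AbelRegularity` from the route's own (R) `UniformAbelianRegularity`
(crux `CoercivePulse.AbelRegularity`, item stmt-AtomisticToContinuum-15384, shared verbatim with
`HoelderEscapeProfile.AbelRegularity`; `--supports` file: it closes nothing, it REDUCES the crux to the existing item
stmt-AtomisticToContinuum-13416; line lead `Sketch`, continuation c1, 2026-08-17)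

WHAT. `abelRegularity_of_uniformAbelianRegularity : UniformAbelianRegularity → AbelRegularity` (hypothesis = the route
decl `CoercivePulse.UniformAbelianRegularity`, item stmt-13416, a child of `AbelThermodynamicLimit` already consumed by this
route's `closes` through `AbelThermodynamicLimitGlueBy_holds`; conclusion = the crux decl, non-oscillation of the Abel means
`A(ν) = ∫₀^∞ e^{-νt} C_T(t) dt` of the summed current autocorrelation of every guarded pair `(μ, D)` of the pinned
anharmonic chain). With this theorem the crux `AbelRegularity` carries no obligation beyond (R) inside the route: it
closes the moment stmt-13416 closes (tenure planner: close-on-close, or `route edit --split AbelRegularity --into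
UniformAbelianRegularity --glue-by` this theorem), exactly as the sibling crux `LinearCeiling` does through
`LinearCeiling.SpikeLemma.linearCeiling_of_uniformAbelianRegularity`. The time-domain line `Sketch`
(`Cruxes/AbelRegularity/Lines/Sketch.lean`: `stub_tameFilteredMemory → AbelRegularity`, S1–S4 landed) is the
independent, (R)-free handle and stays open.

HOW (every ingredient is a landed theorem).
(1) `LoomisCompactHorizonWitness.stub_regularityIffCommonLimit` (⇒): (R) at bath constant `1` gives a regular pair
    `(μ*, D*)` of `pinnedChain ω₂ lam β 1` at `T` and a real `L` with `∫₀^∞ e^{-νt} C_{D*}(t) dt → L` as `ν ↓ 0`;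
(2) the guarded `D` of the crux (any bath constant `γ` — the infinite-volume objects do not see `γ`) is transported
    verbatim to `pinnedChain ω₂ lam β 1` (same carrier, flow, Gibbs state, current autocorrelation);
(3) uniqueness of the shift-invariant DLR state (`eq_of_isChainGibbsMeasure_of_isShiftInvariant_pinnedChain`): `μ = μ*`;
(4) dynamics rigidity (`HeatVarianceCalculus.CanonicalRigidity.flow_ae_eq_canonical`): both `D` and `D*` are the
    canonical Buttà–Marchioro flow `μ`-a.e. at all times, hence have the same `C_T`;
so the crux's Abel means are those of `(μ*, D*)` and converge to `L` (first branch of the dichotomy).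
-/

noncomputable section

namespace Summit.AtomisticToContinuum.FouriersLaw.Theorems.AbelRegularity.Sketch

open MeasureTheory Filter Set
open scoped Topology BigOperators
open Literature.MathematicalPhysics.KineticTheory.HeatConduction

/-- **`AbelRegularity` is a consequence of the route's own (R).** For the pinned anharmonic chain, N-uniform Abelian
regularity of the open chain's equilibrium current autocorrelation (`CoercivePulse.UniformAbelianRegularity`, item
stmt-AtomisticToContinuum-13416) implies that for every guarded pair `(μ, D)` the Abel means
`∫₀^∞ e^{-νt} C_T(t) dt` of the summed current autocorrelation converge in `ℝ` as `ν ↓ 0` — in particular the Abel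
dichotomy `CoercivePulse.AbelRegularity` (item stmt-AtomisticToContinuum-15384). Over landed theorems only: (R) ⇔ common
limit (`stub_regularityIffCommonLimit`), uniqueness of the shift-invariant DLR state, dynamics rigidity onto the
Buttà–Marchioro flow, and transport to bath constant `1`.
[cite: BonettoLebowitzReyBellet2000, §7 eq. (37)] [cite: KunduDharNarayan2009, eqs. (8)–(15)] -/
theorem abelRegularity_of_uniformAbelianRegularity :
    _root_.Summit.AtomisticToContinuum.FouriersLaw.Theses.CoercivePulse.UniformAbelianRegularity →
      _root_.Summit.AtomisticToContinuum.FouriersLaw.Theses.CoercivePulse.AbelRegularity := by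
  intro hR ω₂ lam β γ hω hl hβ T hT μ hG hSI _ D hP _ _ _
  -- (1) (R) ⇒ a regular pair with convergent Abel means, at bath constant 1
  have hR' : _root_.Summit.AtomisticToContinuum.FouriersLaw.Theses.StaticAbelianSqueeze.UniformAbelianRegularity := hR
  obtain ⟨μw, Dw, L, hGw, hSw, hPw, -, hL, -⟩ :=
    (Summit.AtomisticToContinuum.FouriersLaw.Theorems.AbelThermodynamicLimit.LoomisCompactHorizonWitness.stub_regularityIffCommonLimit.mp
      hR') ω₂ lam β 1 hω hl hβ one_pos T hT
  -- (2) transport the guarded dynamics to bath constant 1 (the infinite-volume objects do not see `γ`)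
  let D₁ : InfiniteChainDynamics (pinnedChain ω₂ lam β 1) :=
    ⟨D.carrier, D.flow, D.mapsTo, D.flow_zero, D.isSolution, D.unique⟩
  have hG₁ : (pinnedChain ω₂ lam β 1).IsChainGibbsMeasure T μ := hG
  have hP₁ : D₁.PreservesMeasure μ := hP
  have hcc₁ : ∀ t : ℝ, D.currentCorrelation μ t = D₁.currentCorrelation μ t := fun _ => rfl
  -- (3) uniqueness of the shift-invariant DLR state
  obtain rfl : μ = μw :=
    OscillatorChain.eq_of_isChainGibbsMeasure_of_isShiftInvariant_pinnedChain 1 hω hl.le hβ.le hT hG₁ hSI hGw hSw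
  -- (4) rigidity: `D₁` and `Dw` are both the canonical Buttà–Marchioro flow a.e., at all times
  have hU2 : OscillatorChain.IsEvenPolyOfDegree (pinnedChain ω₂ lam β 1).U 2 :=
    OscillatorChain.pinnedChain_isEvenPolyOfDegree_U β 1 hω.le hl
  have hV2 : OscillatorChain.IsEvenPolyOfDegree (pinnedChain ω₂ lam β 1).V 2 :=
    OscillatorChain.pinnedChain_isEvenPolyOfDegree_V ω₂ lam 1 hβ
  obtain ⟨D', hcar, -, -, -, -, -, -⟩ :=
    OscillatorChain.exists_bmDynamics (P := pinnedChain ω₂ lam β 1) (by norm_num) (by norm_num) hU2 hV2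
  have hrig₁ := HeatVarianceCalculus.CanonicalRigidity.flow_ae_eq_canonical 1 hω hl hβ hT hG₁ hSI D₁ D' hP₁ hcar
  have hrigw := HeatVarianceCalculus.CanonicalRigidity.flow_ae_eq_canonical 1 hω hl hβ hT hG₁ hSI Dw D' hPw hcar
  have hCC : ∀ t : ℝ, D₁.currentCorrelation μ t = Dw.currentCorrelation μ t := fun t => by
    unfold InfiniteChainDynamics.currentCorrelation
    refine tsum_congr fun x => integral_congr_ae ?_
    filter_upwards [hrig₁, hrigw] with σ h₁ h₂
    rw [h₁ t, h₂ t]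
  -- conclusion: the crux's Abel means are those of the (R)-witness, which converge to `L`
  left
  refine ⟨L, ?_⟩
  have e : (fun ν : ℝ => ∫ t in Set.Ioi (0:ℝ), Real.exp (-(ν * t)) * D.currentCorrelation μ t) =
      fun ν : ℝ => ∫ t in Set.Ioi (0:ℝ), Real.exp (-(ν * t)) * Dw.currentCorrelation μ t := by
    funext ν
    simp only [hcc₁, hCC]
  rw [e]
  exact hL

end Summit.AtomisticToContinuum.FouriersLaw.Theorems.AbelRegularity.Sketch

end
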